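import Mathlib
import HarnessLib
import Summits.Langlands.Langlands.Theses.GSpinCensusRung
import Literature.NumberTheory.GaloisRepresentations.AdequateSubgroup
import Literature.NumberTheory.GaloisRepresentations.ResidualRepresentation

/-!
# Birth skeleton (BC3) for crux stmt-Langlands-11943
`Summit.Langlands.Langlands.Theses.GSpinCensusRung.SingularWeightLifting` — line `birth`

Route `route-Langlands-GSpinCensusRung` (`closes : SingularWeightLifting → MoretBaillySeed →
LimitWeightGaloisRep → BeyondTheRung → Langlands`).  The crux (rank 2, "ORDINARY AUTOMORPHY LIFTING
IN THE SINGULAR WEIGHT", BCGP's lifting theorem one node over on the Dynkin diagram) is stated in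
TRANSPORTED form `F ⊆ F'`: for `ρ : Γ_F → GL₆(ℚ̄_p)` over a totally real `F` with the Galois-side
hypotheses of the province (`p > 13`, irreducible, a.e. unramified, odd, `GSp₆`-valued,
Greenberg-ordinary of shape `(0,1,1,2,2,3)` and residually distinguished at `v ∣ p`), a totally real
`F' ⊇ F` with `p` split completely in `F'`, `ρ̄|Γ_{F'(ζ_p)}` absolutely irreducible (Burnside form)
and a SEED `ρ₀` over `F'` (a.e. unramified, Greenberg-ordinary of the same shape at `w ∣ p`,
residually congruent to `ρ|F'`, weakly automorphic of Hodge type `(3; 0,1,1,2,2,3)` for `ι`), the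
restriction `ρ|F'` is weakly automorphic of that Hodge type for `ι`.

This file is the skeleton that concludes the crux BY NAME from three named stubs, cut along the
three inputs every printed automorphy-lifting proof of this shape consumes separately
(base change of the hypotheses ⟶ big residual image ⟶ the lifting engine over ONE field):

* `stub_restrictHypotheses` — TRANSPORT OF THE ORDINARY PROVINCE ALONG A `p`-SPLIT TOTALLY REAL
  EXTENSION: if `ρ` over `F` satisfies the Galois-side hypotheses (`CoreHyp F p ρ`), `p` splits
  completely in `F' ⊇ F` and `ρ̄|Γ_{F'(ζ_p)}` is absolutely irreducible, then `ρ|F'` satisfies the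
  same hypotheses over `F'` (`CoreHyp F' p (ρ|F')`): irreducibility of `ρ|F'` from the absolutely
  irreducible reduction on the open subgroup `Γ_{F'(ζ_p)}` (saturate an invariant line in an
  integral model); a.e. unramified (finitely many primes of `F'` above the bad primes of `F`); odd
  (complex conjugations of the totally real `F'` restrict to complex conjugations of `F`);
  `GSp₆`-valued (tree: `FramedGaloisRep.IsGSpValued.restrictField`); Greenberg-ordinary of shape
  `(0,1,1,2,2,3)` and residually distinguished at every `w ∣ p` of `F'` — for `w ∣ v ∣ p` one has
  `F'_w = F_v = ℚ_p`, and `(ρ|F')|Γ_{F'_w}` is `Γ_F`-conjugate to `ρ|Γ_{F_v}` with inertia mapping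
  into inertia and the cyclotomic character restricting to the cyclotomic character.  The
  definition file `CrystallineOrdinaryShape` records that exactly this restriction invariance is
  NOT in the tree (needs `absInertia_map_absGaloisRestrict_le`, the compatibility of
  `GaloisRep.cyclotomicCharacter` with `absGaloisRestrict`, and `Γ_{F'_w} ≅ Γ_{F_v}` up to
  `Γ_F`-conjugacy).  Size M/L (Lean plumbing; mathematically standard).  It is what makes the
  transported crux follow from the PLAIN form over one field (stub 3).
* `stub_adequateImage` — BIG IMAGE FROM `p > 13 = 2·6 + 1` (Guralnick–Herzig–Taylor–Thorne): a
  framed `ρ : Γ_L → GL_n(ℚ̄_p)` with absolutely irreducible reduction in the Burnside form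
  (`HasAbsolutelyIrreducibleReduction`) and `p ≥ 2(n+1)` has an integral model `ρ₀ : Γ_L → GL_n(𝒪)`,
  `𝒪 = {‖x‖ ≤ 1} ⊂ ℚ̄_p` (tree: `hasAbsolutelyIrreducibleReduction_iff_exists_span_eq_top` gives one
  whose reduction spans `M_n(𝔽̄_p)`), whose reduction `ρ̄₀ : Γ_L → GL_n(𝔽̄_p)` has image spanning
  `M_n(𝔽̄_p)` AND ADEQUATE in Thorne's sense (`Subgroup.IsThorneAdequate`, Thorne 2012 Def. 2.3 with
  the GHTT semisimple clause) — `HasAdequateReduction ρ` below.  This is Thorne 2012, Appendix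
  (Guralnick–Herzig–Taylor–Thorne) Thm. 9: a finite `G ≤ GL_n(𝔽̄_p)` acting absolutely irreducibly
  with `p ≥ 2(n+1)` is adequate (the image of `ρ̄₀` is finite: `isOpen_ker_residualRep`, `Γ_L`
  compact).  It is the crux's clause "adequacy from `p > 2(6+1)` (Thorne2012)", the hypothesis every
  Calegari–Geraghty / Thorne-type patching argument consumes in place of bare absolute
  irreducibility.  Printed, not in the tree; size L to vendor (Serre/Guralnick complete
  reducibility of small modules, `H¹` vanishing).  Cheapest falsifier: none (a theorem); the
  typing is checked against the tree's Burnside bridge.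
* `stub_ordinaryLiftingPlain` — THE ENGINE: ORDINARY AUTOMORPHY LIFTING IN THE SINGULAR WEIGHT
  `(3/2,1/2,1/2)`, PLAIN FORM OVER ONE TOTALLY REAL FIELD `K` (BCGP 2021 Thm. 1.1.3 / §7–8 one node
  over: `GSp₄`, weight `(2,2)`, shape `(0,0,1,1)` ↦ `GSp₆`-valued, Hodge type `(1,2,2,1)`, shape
  `(0,1,1,2,2,3)`): `ρ : Γ_K → GL₆(ℚ̄_p)` with `CoreHyp K p ρ`, `p` split completely in `K`,
  `ρ̄|Γ_{K(ζ_p)}` with ADEQUATE absolutely irreducible reduction (stub 2's output), and a seed `ρ₀`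
  over `K` exactly as the crux types it ⟹ `ρ` is weakly automorphic of Hodge type
  `(3; 0,1,1,2,2,3)` for `ι`.  Inside (not typed, no vocabulary in the tree): integral higher Hida
  theory for the Hodge-type `GSpin(2,5)` Shimura fivefold at the limit weight (ordinary coherent
  complex in two adjacent degrees, perfect of length 1 over the weight algebra, classical in
  regular weights and AT the limit weight), Calegari–Geraghty patching in defect `l₀ = 1`, the
  symplectic doubled-weight ordinary local deformation rings (the weight flag of a `GSp₆`-valued
  Greenberg-ordinary `ρ|Γ_w` of the self-dual shape is isotropic, `Fil_w^⊥ = Fil_{2-w}`, so the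
  local condition lives in the Borel of `GSp₆`; components = orderings of the unit roots, cut out by
  residual distinguishedness), an Ihara-avoidance substitute, local–global compatibility at `p` for
  the seed's `π₀` (its `U_p`-ordinarity is NOT part of the typed seed), transfer
  `GL₆ ↔ SO₇ ↔ SO(2,5)` (Arthur; Ishimoto for the inner form).  Difficulty: open-problem — it
  carries every engine risk named in the crux's why-it-might-fail EXCEPT the two peeled off into
  stubs 1 and 2 (no higher Hida theory for a non-PEL Hodge-type host at a singular weight whose
  limits of discrete series are non-holomorphic; seed not typed symplectic / `U_p`-ordinary).

Shape (for `ledger skeleton check` / `#h21_check_skeleton`): §0 names the crux's clauses as `def`s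
(VERBATIM copies under the route file's `open`s; `crux_iff` is `Iff.rfl`, which certifies it); §1
defines the one new predicate `HasAdequateReduction` over the tree's integral-model / Burnside
bridge and `Subgroup.IsThorneAdequate`; each stub is `theorem stub_<name> (binders) : <conclusion>
:= by sorry`; `_Goal.stub_<name> : Prop := type_of% @stub_<name>` names that statement; the
composition `SingularWeightLifting_of (h₁ : _Goal.stub_restrictHypotheses)
(h₂ : _Goal.stub_adequateImage) (h₃ : _Goal.stub_ordinaryLiftingPlain) : SingularWeightLifting`
is proved without `sorry` and concludes the route decl BY NAME; the last `example` feeds the three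
stubs to it.

Disproof used: none — `ledger crux ls stmt-Langlands-11943` shows no `Disproof.lean`, no
`Negative/` lemma, and the negatives index of the summit has no entry on this crux (2026-08-17).
The refuter's crux-attack (evidence `CruxAttack-stmt-Langlands-11943.md`, `Evidence.lean`:
`singularWeightLifting_of_seedless`) found the statement survives; nothing here contradicts it.
BC3 probes (planner folder `bc/probe_*.lean`): for each stub, `stub → SingularWeightLifting` and
`stub → Langlands` by `first | exact? | simpa | aesop` FAIL (recorded in NOTES.md with rc and the
unsolved goals).
-/

set_option linter.dupNamespace false

noncomputable section

namespace Summit.Langlands.Langlands.Cruxes.SingularWeightLifting.Birth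

open Summit.Langlands.Langlands.Theses.GSpinCensusRung
open scoped BigOperators Topology Manifold Classical MeasureTheory ProbabilityTheory Matrix InnerProductSpace ComplexConjugate ContinuousMap
open Filter Set Function TopologicalSpace MeasureTheory
open Literature.NumberTheory.GaloisRepresentations Literature.NumberTheory.Automorphic Polynomial NumberField IsDedekindDomain Field

/-! ## 0. Named copies of the crux's clauses (verbatim; `crux_iff` below is `Iff.rfl`) -/

/-- The GALOIS-SIDE HYPOTHESES OF THE PROVINCE on `ρ : Γ_K → GL₆(ℚ̄_p)` (verbatim the first
hypothesis block of the crux, there over `F`): `p > 13`; `ρ` irreducible, unramified almost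
everywhere, odd, `GSp₆`-valued; at every `v ∣ p` Greenberg-ordinary of inertial shape
`(0,1,1,2,2,3)` and residually distinguished. [folklore] -/
def CoreHyp (K : Type) [Field K] [NumberField K] (p : ℕ) [Fact p.Prime]
    (ρ : FramedGaloisRep K (PadicAlgCl p) 6) : Prop :=
  13 < p ∧ ρ.toGaloisRep.IsIrreducible ∧
    (∀ᶠ v : HeightOneSpectrum (𝓞 K) in cofinite, ρ.IsUnramifiedAt v) ∧ ρ.IsOdd ∧
      FramedRep.IsGSpValued ρ ∧
        (∀ v : HeightOneSpectrum (𝓞 K), (p : 𝓞 K) ∈ v.asIdeal →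
          ρ.IsGreenbergOrdinaryOfShapeAt v ![0, 1, 1, 2, 2, 3] ∧
            ρ.IsResiduallyDistinguishedAt v ![0, 1, 1, 2, 2, 3])

/-- `p` SPLITS COMPLETELY in the number field `K` (verbatim the crux's clause: every `v ∣ p` has
residue field of cardinality `p` and is unramified, `p ∉ v²`). [folklore] -/
def SplitsCompletelyAt (K : Type) [Field K] [NumberField K] (p : ℕ) : Prop :=
  ∀ v : HeightOneSpectrum (𝓞 K), (p : 𝓞 K) ∈ v.asIdeal →
    Nat.card (𝓞 K ⧸ v.asIdeal) = p ∧ (p : 𝓞 K) ∉ v.asIdeal ^ 2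

/-- `ρ : Γ_K → GL₆(ℚ̄_p)` is WEAKLY AUTOMORPHIC OF HODGE TYPE `(3; 0,1,1,2,2,3)` for `ι` (verbatim the
crux's conclusion and the last seed clause): a cuspidal `π` on `GL₆(𝔸_K)` of pure Hodge infinity
type `(3; {0,1,1,2,2,3})` with Satake–Frobenius matching at almost all finite places. [folklore] -/
def IsWeaklyAutomorphicOfHodgeType (K : Type) [Field K] [NumberField K] (p : ℕ) [Fact p.Prime]
    (ι : PadicAlgCl p ≃+* ℂ) (ρ : FramedGaloisRep K (PadicAlgCl p) 6) : Prop :=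
  ∃ (hcpt : isCompact_glFiniteIntegralLevel 6 K) (π : CuspidalAutomorphicRepData 6 K hcpt),
    π.1.HasHodgeInfinityType 3 {0, 1, 1, 2, 2, 3} ∧
      ∀ᶠ v : HeightOneSpectrum (𝓞 K) in cofinite, SatakeFrobCompatibleAt ι π.1 ρ v

/-- `ρ₀` IS A SEED FOR `ρ` over `K` (verbatim the body of the crux's `∃ ρ₀`): `ρ₀` a.e. unramified,
Greenberg-ordinary of shape `(0,1,1,2,2,3)` at every `v ∣ p`, residually congruent to `ρ`
(`IsResiduallyCongruent`: characteristic polynomials coefficientwise `≡ mod 𝔪`) and weakly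
automorphic of Hodge type `(3; 0,1,1,2,2,3)` for `ι`. [folklore] -/
def IsSeed (K : Type) [Field K] [NumberField K] (p : ℕ) [Fact p.Prime] (ι : PadicAlgCl p ≃+* ℂ)
    (ρ ρ₀ : FramedGaloisRep K (PadicAlgCl p) 6) : Prop :=
  (∀ᶠ v : HeightOneSpectrum (𝓞 K) in cofinite, ρ₀.IsUnramifiedAt v) ∧
    (∀ v : HeightOneSpectrum (𝓞 K), (p : 𝓞 K) ∈ v.asIdeal →
        ρ₀.IsGreenbergOrdinaryOfShapeAt v ![0, 1, 1, 2, 2, 3]) ∧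
      FramedRep.IsResiduallyCongruent ρ ρ₀ ∧ IsWeaklyAutomorphicOfHodgeType K p ι ρ₀

/-- The crux, clause by clause (definitional unfolding of §0; certifies the copies are verbatim). [folklore] -/
theorem crux_iff : SingularWeightLifting ↔
    ∀ (F : Type) [Field F] [NumberField F] [IsTotallyReal F] (p : ℕ) [Fact p.Prime]
      (ι : PadicAlgCl p ≃+* ℂ) (ρ : FramedGaloisRep F (PadicAlgCl p) 6)
      (F' : Type) [Field F'] [NumberField F'] [IsTotallyReal F'] [Algebra F F'],
      CoreHyp F p ρ → SplitsCompletelyAt F' p →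
        FramedRep.HasAbsolutelyIrreducibleReduction
            ((ρ.restrictField F').restrictField (CyclotomicField p F')) →
          (∃ ρ₀ : FramedGaloisRep F' (PadicAlgCl p) 6, IsSeed F' p ι (ρ.restrictField F') ρ₀) →
            IsWeaklyAutomorphicOfHodgeType F' p ι (ρ.restrictField F') :=
  Iff.rfl

/-! ## 1. The notion the engine consumes: adequate (absolutely irreducible) reduction -/

/-- The valuation ring `𝒪 = {‖x‖ ≤ 1}` of `ℚ̄_p = PadicAlgCl p` (Mathlib's `Valued.v.valuationSubring`;
tree: `padicAlgCl_mem_valuationSubring_iff`), the ring of integral models; its residue field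
`IsLocalRing.ResidueField 𝒪` is `𝔽̄_p`. [folklore] -/
abbrev padicAlgClInt (p : ℕ) [Fact p.Prime] : ValuationSubring (PadicAlgCl p) :=
  (Valued.v (R := PadicAlgCl p)).valuationSubring

/-- `ρ : Γ_L → GL_n(ℚ̄_p)` HAS ADEQUATE (ABSOLUTELY IRREDUCIBLE) REDUCTION: there are a frame `P`
and an integral model `ρ₀ : Γ_L → GL_n(𝒪)`, `ρ₀ = P⁻¹ ρ P` (tree: `exists_integralModel`), whose
reduction `ρ̄₀ = ρ₀ mod 𝔪 : Γ_L → GL_n(𝔽̄_p)` has image SPANNING `M_n(𝔽̄_p)` (Burnside: absolute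
irreducibility; exactly the right-hand side of
`hasAbsolutelyIrreducibleReduction_iff_exists_span_eq_top`) AND ADEQUATE in the sense of Thorne
2012, Def. 2.3 (`Subgroup.IsThorneAdequate` of the image subgroup of `GL_n(𝔽̄_p)`).  Applied to
`ρ|Γ_{K(ζ_p)}` this is Thorne's standing hypothesis "`ρ̄(G_{F(ζ_l)})` adequate".
[cite: Thorne2012, Def. 2.3 and Thm. 7.1] -/
def HasAdequateReduction {L : Type} [Field L] {p : ℕ} [Fact p.Prime] {n : ℕ}
    (ρ : FramedGaloisRep L (PadicAlgCl p) n) : Prop :=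
  ∃ (P : GL (Fin n) (PadicAlgCl p)) (ρ₀ : absoluteGaloisGroup L →* GL (Fin n) (padicAlgClInt p)),
    (∀ σ, Matrix.GeneralLinearGroup.map (padicAlgClInt p).subtype (ρ₀ σ) = P⁻¹ * ρ σ * P) ∧
      Submodule.span (IsLocalRing.ResidueField (padicAlgClInt p))
          (Set.range fun σ =>
            (((Matrix.GeneralLinearGroup.map (IsLocalRing.residue (padicAlgClInt p))).comp ρ₀ σ :
                GL (Fin n) (IsLocalRing.ResidueField (padicAlgClInt p))) :
              Matrix (Fin n) (Fin n) (IsLocalRing.ResidueField (padicAlgClInt p)))) = ⊤ ∧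
        Subgroup.IsThorneAdequate
          ((Matrix.GeneralLinearGroup.map (IsLocalRing.residue (padicAlgClInt p))).comp ρ₀).range

/-! ## 2. The three stubs -/

/-- **STUB 1 — transport of the ordinary province along a `p`-split totally real extension.**
If `ρ : Γ_F → GL₆(ℚ̄_p)` satisfies the Galois-side hypotheses of the province over the totally real
`F` (`CoreHyp F p ρ`), `F' ⊇ F` is totally real with `p` split completely in `F'`, and
`ρ̄|Γ_{F'(ζ_p)}` is absolutely irreducible (Burnside form), then `ρ|F' = ρ.restrictField F'`
satisfies the same hypotheses over `F'`: `p > 13` (kept); IRREDUCIBLE (an invariant subspace of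
`ρ|F'` is one of `ρ|Γ_{F'(ζ_p)}`, and saturating it in an integral model contradicts the spanning
reduction); A.E. UNRAMIFIED (the primes of `F'` above the finitely many ramified primes of `F` are
finitely many; inertia at `w` maps into inertia at `v = w ∩ F`); ODD (a complex conjugation of `F'`
for `φ' : F' → ℝ` restricts to one of `F` for `φ'|F`, `det` unchanged); `GSp₆`-VALUED (tree lemma
`FramedGaloisRep.IsGSpValued.restrictField`); GREENBERG-ORDINARY OF SHAPE `(0,1,1,2,2,3)` AND
RESIDUALLY DISTINGUISHED at every `w ∣ p` of `F'`: `p` split completely in `F'` forces it split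
completely in `F`, `F'_w = F_v = ℚ_p` for `v = w ∩ F`, and `(ρ|F').toLocal w` is conjugate (by an
element of `ρ(Γ_F)`, frames are free) to `ρ.toLocal v` composed with an isomorphism
`Γ_{F'_w} ≅ Γ_{F_v}` carrying inertia onto inertia and `ε` to `ε` — the three predicates are
frame-independent (`…_conj_iff`, proved) and defined through `toLocal`.  Why plausibly true:
standard base change of local conditions; why it might fail as typed: only through a mismatch of
the tree's chosen embeddings `absGaloisRestrict` (decomposition group at `w` inside `Γ_F` is the
one at `v` only up to `Γ_F`-conjugacy — harmless for conjugation-invariant predicates).  The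
definition file `CrystallineOrdinaryShape` lists the missing tree facts
(`absInertia_map_absGaloisRestrict_le`, cyclotomic compatibility, `Γ_{K'_w} ≅ Γ_{K_v}`).  Size M/L.
Leans on: `FramedGaloisRep.restrictField/toLocal`, `IsGreenbergOrdinaryOfShapeAt`,
`IsResiduallyDistinguishedAt`, `IsGSpValued.restrictField`, `IsOdd`, `IsUnramifiedAt`,
`hasAbsolutelyIrreducibleReduction_iff_exists_span_eq_top` (tree).
[cite: BoxerEtAl2021, §7.1 (hypotheses stable under the solvable/p-split base changes used in §9)] [cite: SerreAbelianLadic1968, Ch. I §2.1] -/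
theorem stub_restrictHypotheses (F : Type) [Field F] [NumberField F] [IsTotallyReal F] (p : ℕ)
    [Fact p.Prime] (ρ : FramedGaloisRep F (PadicAlgCl p) 6) (F' : Type) [Field F'] [NumberField F']
    [IsTotallyReal F'] [Algebra F F'] (hcore : CoreHyp F p ρ) (hsplit' : SplitsCompletelyAt F' p)
    (hres' : FramedRep.HasAbsolutelyIrreducibleReduction
      ((ρ.restrictField F').restrictField (CyclotomicField p F'))) :
    CoreHyp F' p (ρ.restrictField F') := by
  sorry

/-- **STUB 2 — big residual image from `p ≥ 2(n+1)` (Guralnick–Herzig–Taylor–Thorne).**  A framed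
`ρ : Γ_L → GL_n(ℚ̄_p)` (any field `L`; `Γ_L` is compact) whose reduction is absolutely irreducible in
the Burnside form, with `p ≥ 2(n+1)`, has ADEQUATE absolutely irreducible reduction
(`HasAdequateReduction`): take the integral model `ρ₀ = P⁻¹ ρ P : Γ_L → GL_n(𝒪)` with spanning
reduction provided by `hasAbsolutelyIrreducibleReduction_iff_exists_span_eq_top` (with
`padicAlgCl_mem_valuationSubring_iff`); its reduction `ρ̄₀` has open kernel
(`isOpen_ker_residualRep`), hence FINITE image `G ≤ GL_n(𝔽̄_p)` acting absolutely irreducibly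
(Burnside), and GHTT Thm. 9 says a finite absolutely irreducible `G ≤ GL_n(𝔽̄_p)` with
`p ≥ 2(n+1)` is adequate (clause (iv) in the semisimple form of GHTT Lemma 1, as the tree's
`Subgroup.IsThorneAdequate` states it; `p > n` so `p ∤ n` and `(ad⁰)^G = 0` is consistent).  In the
line it is applied with `L = F'(ζ_p)`, `n = 6`, `p > 13`, i.e. `p ≥ 17 > 14 = 2(6+1)`: the crux's
"adequacy from `p > 2(6+1)` (Thorne2012)".  Why it might fail: it is a printed theorem; the only
risk is the typing of the reduction (frame `P⁻¹ ρ P`, residue map of the valuation ring of `ℚ̄_p`),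
checked against the tree's bridge lemma whose right-hand side is copied verbatim.  Size L to vendor
(Guralnick's complete reducibility of modules of dimension `< (p-1)/2`… , `H¹(G, k) = 0`,
`H¹(G, ad⁰) = 0`).  Leans on: `HasAbsolutelyIrreducibleReduction`,
`hasAbsolutelyIrreducibleReduction_iff_exists_span_eq_top`, `isOpen_ker_residualRep`,
`Subgroup.IsThorneAdequate` (tree); Mathlib `Valued.v`, `ValuationSubring`, `IsLocalRing.residue`.
[cite: Thorne2012, Appendix (Guralnick–Herzig–Taylor–Thorne) Thm. 9 and Lemma 1; Def. 2.3] -/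
theorem stub_adequateImage (L : Type) [Field L] (p : ℕ) [Fact p.Prime] (n : ℕ)
    (hp : 2 * (n + 1) ≤ p) (ρ : FramedGaloisRep L (PadicAlgCl p) n)
    (hρ : FramedRep.HasAbsolutelyIrreducibleReduction ρ) : HasAdequateReduction ρ := by
  sorry

/-- **STUB 3 — the engine: ordinary automorphy lifting in the singular weight, plain form over one
totally real field** (the hardest stub; difficulty open-problem).  Let `K` be totally real with `p`
split completely, `ρ : Γ_K → GL₆(ℚ̄_p)` with the Galois-side hypotheses of the province
(`CoreHyp K p ρ`: `p > 13`, irreducible, a.e. unramified, odd, `GSp₆`-valued, Greenberg-ordinary of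
shape `(0,1,1,2,2,3)` and residually distinguished at every `v ∣ p`), whose restriction to
`Γ_{K(ζ_p)}` has ADEQUATE absolutely irreducible reduction (`HasAdequateReduction`, stub 2's output
— what a Thorne / Calegari–Geraghty-type patching argument consumes), and let `ρ₀` be a seed over
`K` (a.e. unramified, Greenberg-ordinary of the same shape at `v ∣ p`, residually congruent to `ρ`,
weakly automorphic of Hodge type `(3; 0,1,1,2,2,3)` for `ι`).  Then `ρ` is weakly automorphic of
Hodge type `(3; 0,1,1,2,2,3)` for `ι`: a cuspidal `π` on `GL₆(𝔸_K)` of that (non-regular) Hodge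
infinity type with Satake–Frobenius matching almost everywhere.  This is Boxer–Calegari–Gee–Pilloni's
Thm. 1.1.3 moved one node over on the Dynkin diagram (`GSp₄`, weight `(2,2)`, shape `(0,0,1,1)` ↦
`GSp₆`-valued, Hodge vector `(1,2,2,1)`, shape `(0,1,1,2,2,3)`; host: the Hodge-type `GSpin(2,5)`
Shimura fivefold, non-degenerate limits of discrete series at infinitesimal character
`(3/2,1/2,1/2)` in coherent cohomology of two adjacent degrees).  Intended proof: integral higher
Hida theory for that host at the limit weight (perfect length-1 ordinary complex over the weight
algebra, classical in regular weights and at the limit weight), Calegari–Geraghty patching in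
defect `l₀ = 1` over the symplectic doubled-weight ordinary local deformation rings (the weight
flag of `ρ|Γ_v` is isotropic, `Fil_w^⊥ = Fil_{2-w}`, by uniqueness of the weight filtration and
self-duality of the shape; components ordered by residual distinguishedness), Ihara avoidance,
local–global compatibility at `p` making the seed's `π₀` `U_p`-ordinary, transfer
`GL₆ ↔ SO₇ ↔ SO(2,5)`.  Why it might fail: no higher Hida theory / defect-1 patching exists for a
non-PEL Hodge-type host at a singular weight whose limits of discrete series are non-holomorphic
(coherent `H¹/H²`, not BCGP's `H⁰/H¹`); the typed seed is not required symplectic-type nor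
`U_p`-ordinary on `GSpin₇`; BCGP moreover used vast + tidy image where only adequacy is supplied.
Leans on: `CoreHyp`, `SplitsCompletelyAt`, `HasAdequateReduction`, `IsSeed`,
`IsWeaklyAutomorphicOfHodgeType` (this file, over tree notions only).
[cite: BoxerEtAl2021, Thm. 1.1.3 and §§7–8] [cite: CalegariGeraghty2017, §1] [cite: Thorne2012, Thm. 7.1] [cite: Pilloni2020, Thm. 1.1] -/
theorem stub_ordinaryLiftingPlain (K : Type) [Field K] [NumberField K] [IsTotallyReal K] (p : ℕ)
    [Fact p.Prime] (ι : PadicAlgCl p ≃+* ℂ) (ρ : FramedGaloisRep K (PadicAlgCl p) 6)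
    (hcore : CoreHyp K p ρ) (hsplit : SplitsCompletelyAt K p)
    (hadq : HasAdequateReduction (ρ.restrictField (CyclotomicField p K)))
    (hseed : ∃ ρ₀ : FramedGaloisRep K (PadicAlgCl p) 6, IsSeed K p ι ρ ρ₀) :
    IsWeaklyAutomorphicOfHodgeType K p ι ρ := by
  sorry

/-! ## 3. The stub statements as named `Prop`s (literally the types of the stubs; no `sorry` inherited) -/

namespace _Goal

/-- The statement of `stub_restrictHypotheses`, as a named `Prop` (literally its type). [folklore] -/
def stub_restrictHypotheses : Prop :=
  type_of% @Summit.Langlands.Langlands.Cruxes.SingularWeightLifting.Birth.stub_restrictHypotheses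

/-- The statement of `stub_adequateImage`, as a named `Prop` (literally its type). [folklore] -/
def stub_adequateImage : Prop :=
  type_of% @Summit.Langlands.Langlands.Cruxes.SingularWeightLifting.Birth.stub_adequateImage

/-- The statement of `stub_ordinaryLiftingPlain`, as a named `Prop` (literally its type). [folklore] -/
def stub_ordinaryLiftingPlain : Prop :=
  type_of% @Summit.Langlands.Langlands.Cruxes.SingularWeightLifting.Birth.stub_ordinaryLiftingPlain

end _Goal

/-! ## 4. The composition (kernel-checked, no `sorry`): TRANSPORT → BIG IMAGE → ENGINE → crux by name -/

/-- **The crux from the three stubs.**  Given the crux data `(F, p, ι, ρ, F')` with the Galois-side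
hypotheses over `F`, `p` split completely in `F'`, `ρ̄|Γ_{F'(ζ_p)}` absolutely irreducible and a
seed over `F'`: STUB 1 transports the hypotheses to `ρ|F'` over `F'`; STUB 2 (with `n = 6`,
`2·(6+1) = 14 ≤ p` from `13 < p`) upgrades the absolutely irreducible reduction of `ρ|Γ_{F'(ζ_p)}` to
an adequate one; STUB 3 (the engine over the single field `F'`) returns the cuspidal `π'` of Hodge
type `(3; 0,1,1,2,2,3)` matching `ρ|F'`.  Hypotheses are, by name, the statements of the three stubs;
the conclusion is the route decl `SingularWeightLifting`. [folklore] -/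
theorem SingularWeightLifting_of (h₁ : _Goal.stub_restrictHypotheses)
    (h₂ : _Goal.stub_adequateImage) (h₃ : _Goal.stub_ordinaryLiftingPlain) :
    SingularWeightLifting := by
  -- read the three named statements
  have hTransport : ∀ (F : Type) [Field F] [NumberField F] [IsTotallyReal F] (p : ℕ) [Fact p.Prime]
      (ρ : FramedGaloisRep F (PadicAlgCl p) 6) (F' : Type) [Field F'] [NumberField F']
      [IsTotallyReal F'] [Algebra F F'], CoreHyp F p ρ → SplitsCompletelyAt F' p →
        FramedRep.HasAbsolutelyIrreducibleReduction
          ((ρ.restrictField F').restrictField (CyclotomicField p F')) →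
        CoreHyp F' p (ρ.restrictField F') := h₁
  have hImage : ∀ (L : Type) [Field L] (p : ℕ) [Fact p.Prime] (n : ℕ), 2 * (n + 1) ≤ p →
      ∀ ρ : FramedGaloisRep L (PadicAlgCl p) n,
        FramedRep.HasAbsolutelyIrreducibleReduction ρ → HasAdequateReduction ρ := h₂
  have hEngine : ∀ (K : Type) [Field K] [NumberField K] [IsTotallyReal K] (p : ℕ) [Fact p.Prime]
      (ι : PadicAlgCl p ≃+* ℂ) (ρ : FramedGaloisRep K (PadicAlgCl p) 6),
      CoreHyp K p ρ → SplitsCompletelyAt K p →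
        HasAdequateReduction (ρ.restrictField (CyclotomicField p K)) →
          (∃ ρ₀ : FramedGaloisRep K (PadicAlgCl p) 6, IsSeed K p ι ρ ρ₀) →
            IsWeaklyAutomorphicOfHodgeType K p ι ρ := h₃
  -- the crux, clause by clause
  rw [crux_iff]
  intro F _ _ _ p _ ι ρ F' _ _ _ _ hcore hsplit' hres' hseed
  -- STUB 1: transport the Galois-side hypotheses from `F` to `F'`
  have hcore' : CoreHyp F' p (ρ.restrictField F') := hTransport F p ρ F' hcore hsplit' hres'
  -- STUB 2: `p > 13 = 2·6 + 1`, so the absolutely irreducible reduction of `ρ|Γ_{F'(ζ_p)}` is adequate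
  have hp : 2 * (6 + 1) ≤ p := by
    have h13 : 13 < p := hcore.1
    omega
  have hadq : HasAdequateReduction ((ρ.restrictField F').restrictField (CyclotomicField p F')) :=
    hImage (CyclotomicField p F') p 6 hp _ hres'
  -- STUB 3: the lifting engine over the single field `F'`
  exact hEngine F' p ι (ρ.restrictField F') hcore' hsplit' hadq hseed

/-- By-name sanity check (an `example`, so it is not a declaration of the file): the three stubs feed
the composition as they stand. -/
example : SingularWeightLifting :=
  SingularWeightLifting_of stub_restrictHypotheses stub_adequateImage stub_ordinaryLiftingPlain

end Summit.Langlands.Langlands.Cruxes.SingularWeightLifting.Birth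

end
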